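import Mathlib.Analysis.SpecialFunctions.Trigonometric.Bounds
import Mathlib.Analysis.Real.Pi.Bounds

/-!
# The LTT octahedral-tilt lever on in-plane hopping and exchange anisotropy (Normand–Kampf 2001, Eq. (1))

In the low-temperature-tetragonal (LTT) phase of the La-214 cuprates the CuO₆ octahedra tilt by an
angle `Φ` about an axis PARALLEL to a Cu–O bond, so the buckling affects the `x` and `y` bonds
unequally (in the LTO phase the axis is `[110]` and both bonds are affected equally).  For a `(1,0)`
LTT tilt Normand and Kampf print the angular estimate [NormandKampf2001, Eq. (1)]
`t_y = t_x |cos(π − 2Φ)|`, `J_y = J_x cos²(π − 2Φ)`,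
and the worked number «for a maximal distortion angle `Φ = 5°`, the relative anisotropies
`|t_x − t_y|/t_x ∼ 1.5 %` and `|J_x − J_y|/J_x ∼ 3 %`» [NormandKampf2001, p. 2].  The measured LTT
tilts of La₂₋ₓBaₓCuO₄ run from `4.0°` (`x = 0.095`) to `2.4°` (`x = 0.155`), `3.3°` at `x = 1/8`,
with a critical tilt `3.6°` separating bulk-superconducting from non-superconducting LTT samples
[HuckerEtAl2011, §4 p. 10].

Here the two printed factors are DEFINITIONS (`lttHoppingFactor Φ = |cos(π − 2Φ)|`,
`lttExchangeFactor Φ = cos²(π − 2Φ)`), the anisotropies `ε_t = 1 − t_y/t_x`, `ε_J = 1 − J_y/J_x` are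
their complements, and the theorems are the exact algebra a box writer needs:

* `J`'s factor is the SQUARE of `t`'s factor (all `Φ`) — consistent with `J ∝ t²`;
* for `0 ≤ Φ ≤ π/4`: `t_y/t_x = cos 2Φ`, `ε_t = 1 − cos 2Φ = 2 sin²Φ`, `ε_J = sin²2Φ = ε_t(2 − ε_t)`,
  hence `ε_J ≤ 2ε_t` («3 % vs 1.5 %»);
* bounds with no trigonometry left: `2(Φ − Φ³/6)² < ε_t ≤ 2Φ²` for `0 < Φ ≤ 1` (radians), and `ε_t`
  is strictly increasing on `[0, π/2]`;
* instances: `Φ = 5° = π/36` ⇒ `ε_t ∈ (0.0151, 0.0153)`, `ε_J ∈ (0.0299, 0.0305)` (the printed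
  ∼1.5 % / ∼3 %); `Φ = 3.3° = 11π/600` (La₁.₈₇₅Ba₀.₁₂₅CuO₄) ⇒ `ε_t ∈ (0.00662, 0.00664)`;
  `Φ_c = 3.6° = π/50` ⇒ `ε_t ∈ (0.00788, 0.0079)` — i.e. below 1 % in `t` at every validation tilt.

Not here: the tight-binding/orbital-overlap derivation of Eq. (1) (their ref. 47), any claim that real
La-214 hoppings follow it, stripe energetics, or the LTO case beyond the remark above.

References: B. Normand, A. P. Kampf, Phys. Rev. B 64 (2001) 024521, arXiv:cond-mat/0102201, Eq. (1)
and p. 2; M. Hücker et al., Phys. Rev. B 83 (2011) 104506, arXiv:1005.5191, §4 (p. 10 of the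
preprint).  AI-produced formalisation (H21, cell hubbard-downfold, seat lit-2, 2026-08-27); no facts,
no axioms beyond Mathlib's, no `sorry`.
-/

namespace Literature.MathematicalPhysics.QuantumLattice

open Real

noncomputable section

/-! ## 1. The printed factors and the anisotropies -/

/-- `t_y/t_x = |cos(π − 2Φ)|` for a `(1,0)` LTT tilt `Φ`. [cite: NormandKampf2001, Eq. (1)] -/
def lttHoppingFactor (Φ : ℝ) : ℝ := |cos (π - 2 * Φ)|

/-- `J_y/J_x = cos²(π − 2Φ)`. [cite: NormandKampf2001, Eq. (1)] -/
def lttExchangeFactor (Φ : ℝ) : ℝ := cos (π - 2 * Φ) ^ 2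

/-- Hopping anisotropy `ε_t = |t_x − t_y|/t_x = 1 − t_y/t_x`. [cite: NormandKampf2001, p. 2] -/
def lttHoppingAnisotropy (Φ : ℝ) : ℝ := 1 - lttHoppingFactor Φ

/-- Exchange anisotropy `ε_J = |J_x − J_y|/J_x = 1 − J_y/J_x`. [cite: NormandKampf2001, p. 2] -/
def lttExchangeAnisotropy (Φ : ℝ) : ℝ := 1 - lttExchangeFactor Φ

/-- Unfolding. [cite: NormandKampf2001, Eq. (1)] -/
theorem lttHoppingFactor_def (Φ : ℝ) : lttHoppingFactor Φ = |cos (π - 2 * Φ)| := rfl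

/-- Unfolding. [cite: NormandKampf2001, Eq. (1)] -/
theorem lttExchangeFactor_def (Φ : ℝ) : lttExchangeFactor Φ = cos (π - 2 * Φ) ^ 2 := rfl

/-- Unfolding. [cite: NormandKampf2001, p. 2] -/
theorem lttHoppingAnisotropy_def (Φ : ℝ) : lttHoppingAnisotropy Φ = 1 - lttHoppingFactor Φ := rfl

/-- Unfolding. [cite: NormandKampf2001, p. 2] -/
theorem lttExchangeAnisotropy_def (Φ : ℝ) : lttExchangeAnisotropy Φ = 1 - lttExchangeFactor Φ := rfl

/-! ## 2. Exact identities -/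

/-- **`J ∝ t²` consistency**: the exchange factor is the square of the hopping factor, for every `Φ`.
[cite: NormandKampf2001, Eq. (1)] -/
theorem lttExchangeFactor_eq_sq (Φ : ℝ) : lttExchangeFactor Φ = lttHoppingFactor Φ ^ 2 := by
  rw [lttExchangeFactor, lttHoppingFactor, sq_abs]

/-- No tilt, no anisotropy: `t_y/t_x = 1` at `Φ = 0`. [cite: NormandKampf2001, Eq. (1)] -/
theorem lttHoppingFactor_zero : lttHoppingFactor 0 = 1 := by
  rw [lttHoppingFactor, mul_zero, sub_zero, cos_pi]; norm_num

/-- `ε_t(0) = 0`. [cite: NormandKampf2001, Eq. (1)] -/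
theorem lttHoppingAnisotropy_zero : lttHoppingAnisotropy 0 = 0 := by
  rw [lttHoppingAnisotropy, lttHoppingFactor_zero, sub_self]

/-- `|cos(π − 2Φ)| = |cos 2Φ|` (all `Φ`). [cite: NormandKampf2001, Eq. (1)] -/
theorem lttHoppingFactor_eq_abs_cos (Φ : ℝ) : lttHoppingFactor Φ = |cos (2 * Φ)| := by
  rw [lttHoppingFactor, cos_pi_sub, abs_neg]

/-- For tilts `0 ≤ Φ ≤ π/4` (every physical case: `Φ ≲ 5°`): `t_y/t_x = cos 2Φ`.
[cite: NormandKampf2001, Eq. (1)] -/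
theorem lttHoppingFactor_eq_cos {Φ : ℝ} (h0 : 0 ≤ Φ) (h1 : Φ ≤ π / 4) :
    lttHoppingFactor Φ = cos (2 * Φ) := by
  rw [lttHoppingFactor_eq_abs_cos]
  exact abs_of_nonneg (cos_nonneg_of_neg_pi_div_two_le_of_le (by linarith [pi_pos]) (by linarith))

/-- `ε_t = 1 − cos 2Φ = 2 sin²Φ` on `0 ≤ Φ ≤ π/4`. [cite: NormandKampf2001, Eq. (1)] -/
theorem lttHoppingAnisotropy_eq {Φ : ℝ} (h0 : 0 ≤ Φ) (h1 : Φ ≤ π / 4) :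
    lttHoppingAnisotropy Φ = 2 * sin Φ ^ 2 := by
  rw [lttHoppingAnisotropy, lttHoppingFactor_eq_cos h0 h1, cos_two_mul, cos_sq']
  ring

/-- `ε_J = 1 − cos²2Φ = sin²2Φ` (all `Φ`). [cite: NormandKampf2001, Eq. (1)] -/
theorem lttExchangeAnisotropy_eq (Φ : ℝ) : lttExchangeAnisotropy Φ = sin (2 * Φ) ^ 2 := by
  rw [lttExchangeAnisotropy, lttExchangeFactor, cos_pi_sub, neg_sq, cos_sq']
  ring

/-- `ε_J = ε_t(2 − ε_t)` (all `Φ`): the exchange anisotropy is exactly twice the hopping anisotropy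
to leading order. [cite: NormandKampf2001, p. 2] -/
theorem lttExchangeAnisotropy_eq_hopping (Φ : ℝ) :
    lttExchangeAnisotropy Φ = lttHoppingAnisotropy Φ * (2 - lttHoppingAnisotropy Φ) := by
  rw [lttExchangeAnisotropy, lttExchangeFactor_eq_sq, lttHoppingAnisotropy]
  ring

/-- Hence `ε_J ≤ 2ε_t` whenever `ε_t ≥ 0` (always: `|cos| ≤ 1`). [cite: NormandKampf2001, p. 2] -/
theorem lttExchangeAnisotropy_le_two_mul (Φ : ℝ) :
    lttExchangeAnisotropy Φ ≤ 2 * lttHoppingAnisotropy Φ := by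
  rw [lttExchangeAnisotropy_eq_hopping]
  have h : 0 ≤ lttHoppingAnisotropy Φ := by
    rw [lttHoppingAnisotropy, lttHoppingFactor, sub_nonneg]
    exact abs_cos_le_one _
  nlinarith

/-- `0 ≤ ε_t ≤ 1` for every tilt. [cite: NormandKampf2001, Eq. (1)] -/
theorem lttHoppingAnisotropy_mem_Icc (Φ : ℝ) : lttHoppingAnisotropy Φ ∈ Set.Icc (0 : ℝ) 1 := by
  rw [lttHoppingAnisotropy, lttHoppingFactor, Set.mem_Icc]
  exact ⟨by linarith [abs_cos_le_one (π - 2 * Φ)], by linarith [abs_nonneg (cos (π - 2 * Φ))]⟩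

/-! ## 3. Trigonometry-free bounds and monotonicity -/

/-- Upper bound `ε_t ≤ 2Φ²` for `0 ≤ Φ ≤ π/4` (from `sin Φ ≤ Φ`). [cite: NormandKampf2001, Eq. (1)] -/
theorem lttHoppingAnisotropy_le_two_sq {Φ : ℝ} (h0 : 0 ≤ Φ) (h1 : Φ ≤ π / 4) :
    lttHoppingAnisotropy Φ ≤ 2 * Φ ^ 2 := by
  rw [lttHoppingAnisotropy_eq h0 h1]
  have hs0 : 0 ≤ sin Φ := sin_nonneg_of_nonneg_of_le_pi h0 (by linarith [pi_pos])
  have hs1 : sin Φ ≤ Φ := sin_le h0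
  nlinarith

/-- Lower bound `2(Φ − Φ³/6)² < ε_t` for `0 < Φ ≤ π/4` (from `Φ − Φ³/6 < sin Φ`).
[cite: NormandKampf2001, Eq. (1)] -/
theorem two_mul_sq_lt_lttHoppingAnisotropy {Φ : ℝ} (h0 : 0 < Φ) (h1 : Φ ≤ π / 4) :
    2 * (Φ - Φ ^ 3 / 6) ^ 2 < lttHoppingAnisotropy Φ := by
  rw [lttHoppingAnisotropy_eq h0.le h1]
  have hs : Φ - Φ ^ 3 / 6 < sin Φ := sin_gt_sub_cube h0
  have hπ := pi_lt_d4
  have hΦ1 : Φ ≤ 1 := by linarith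
  have hsq : Φ ^ 2 ≤ 1 := by nlinarith
  have hcu : Φ ^ 3 ≤ Φ := by nlinarith
  have hc : 0 ≤ Φ - Φ ^ 3 / 6 := by linarith
  nlinarith

/-- `ε_t` is strictly increasing in the tilt on `[0, π/4]`. [cite: NormandKampf2001, Eq. (1)] -/
theorem lttHoppingAnisotropy_strictMonoOn :
    StrictMonoOn lttHoppingAnisotropy (Set.Icc 0 (π / 4)) := by
  intro a ha b hb hab
  rw [Set.mem_Icc] at ha hb
  rw [lttHoppingAnisotropy_eq ha.1 ha.2, lttHoppingAnisotropy_eq hb.1 hb.2]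
  have hπ := pi_pos
  have ha' : a ∈ Set.Icc (-(π / 2)) (π / 2) := ⟨by linarith, by linarith⟩
  have hb' : b ∈ Set.Icc (-(π / 2)) (π / 2) := ⟨by linarith, by linarith⟩
  have hsin : sin a < sin b := strictMonoOn_sin ha' hb' hab
  have hsa : 0 ≤ sin a := sin_nonneg_of_nonneg_of_le_pi ha.1 (by linarith)
  nlinarith

/-! ## 4. Instances at the printed and measured tilts -/

/-- Plumbing: `π/36 ∈ (0.08726, 0.08727)` and `π/36 ≤ π/4`. [folklore] -/
private lemma pi_div_36_bounds : (0.08726 : ℝ) < π / 36 ∧ π / 36 < 0.08727 ∧ π / 36 ≤ π / 4 := by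
  have h1 := pi_gt_d4
  have h2 := pi_lt_d4
  refine ⟨by linarith, by linarith, by linarith [pi_pos]⟩

/-- **The printed 1.5 %**: at `Φ = 5° = π/36`, `ε_t ∈ (0.0151, 0.0153)`.
[cite: NormandKampf2001, p. 2] -/
theorem lttHoppingAnisotropy_five_deg :
    (0.0151 : ℝ) < lttHoppingAnisotropy (π / 36) ∧ lttHoppingAnisotropy (π / 36) < 0.0153 := by
  obtain ⟨hlo, hhi, hq⟩ := pi_div_36_bounds
  have hx0 : 0 < π / 36 := by linarith
  constructor
  · have hl := two_mul_sq_lt_lttHoppingAnisotropy hx0 hq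
    have hcube : (π / 36) ^ 3 < 0.000665 :=
      calc (π / 36) ^ 3 = (π / 36) * (π / 36) * (π / 36) := by ring
        _ < 0.08727 * 0.08727 * 0.08727 := by gcongr
        _ < 0.000665 := by norm_num
    have hbase : (0.08714 : ℝ) < π / 36 - (π / 36) ^ 3 / 6 := by linarith
    nlinarith
  · have hu := lttHoppingAnisotropy_le_two_sq hx0.le hq
    nlinarith

/-- **The printed 3 %**: at `Φ = 5°`, `ε_J = ε_t(2 − ε_t) ∈ (0.0299, 0.0305)`.
[cite: NormandKampf2001, p. 2] -/
theorem lttExchangeAnisotropy_five_deg :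
    (0.0299 : ℝ) < lttExchangeAnisotropy (π / 36) ∧ lttExchangeAnisotropy (π / 36) < 0.0305 := by
  obtain ⟨hlo, hhi⟩ := lttHoppingAnisotropy_five_deg
  rw [lttExchangeAnisotropy_eq_hopping]
  constructor <;> nlinarith

/-- Plumbing: `11π/600 ∈ (0.057594, 0.057597)` and `≤ π/4`. [folklore] -/
private lemma pi_11_div_600_bounds :
    (0.057594 : ℝ) < 11 * π / 600 ∧ 11 * π / 600 < 0.057597 ∧ 11 * π / 600 ≤ π / 4 := by
  have h1 := pi_gt_d4
  have h2 := pi_lt_d4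
  refine ⟨by linarith, by linarith, by linarith [pi_pos]⟩

/-- At the La₁.₈₇₅Ba₀.₁₂₅CuO₄ tilt `Φ = 3.3° = 11π/600`: `ε_t ∈ (0.00662, 0.00664)` — below 1 % in `t`.
[cite: HuckerEtAl2011, §4 p. 10] -/
theorem lttHoppingAnisotropy_lbco_eighth :
    (0.00662 : ℝ) < lttHoppingAnisotropy (11 * π / 600) ∧
      lttHoppingAnisotropy (11 * π / 600) < 0.00664 := by
  obtain ⟨hlo, hhi, hq⟩ := pi_11_div_600_bounds
  have hx0 : 0 < 11 * π / 600 := by linarith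
  constructor
  · have hl := two_mul_sq_lt_lttHoppingAnisotropy hx0 hq
    have hcube : (11 * π / 600) ^ 3 < 0.000192 :=
      calc (11 * π / 600) ^ 3 = (11 * π / 600) * (11 * π / 600) * (11 * π / 600) := by ring
        _ < 0.057597 * 0.057597 * 0.057597 := by gcongr
        _ < 0.000192 := by norm_num
    have hbase : (0.057562 : ℝ) < 11 * π / 600 - (11 * π / 600) ^ 3 / 6 := by linarith
    nlinarith
  · have hu := lttHoppingAnisotropy_le_two_sq hx0.le hq
    nlinarith

/-- Plumbing: `π/50 ∈ (0.06283, 0.062832)` and `≤ π/4`. [folklore] -/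
private lemma pi_div_50_bounds : (0.06283 : ℝ) < π / 50 ∧ π / 50 < 0.062832 ∧ π / 50 ≤ π / 4 := by
  have h1 := pi_gt_d4
  have h2 := pi_lt_d4
  refine ⟨by linarith, by linarith, by linarith [pi_pos]⟩

/-- At the critical tilt `Φ_c = 3.6° = π/50`: `ε_t ∈ (0.00788, 0.0079)`.
[cite: HuckerEtAl2011, §4 p. 10] -/
theorem lttHoppingAnisotropy_critical_tilt :
    (0.00788 : ℝ) < lttHoppingAnisotropy (π / 50) ∧ lttHoppingAnisotropy (π / 50) < 0.0079 := by
  obtain ⟨hlo, hhi, hq⟩ := pi_div_50_bounds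
  have hx0 : 0 < π / 50 := by linarith
  constructor
  · have hl := two_mul_sq_lt_lttHoppingAnisotropy hx0 hq
    have hcube : (π / 50) ^ 3 < 0.000249 :=
      calc (π / 50) ^ 3 = (π / 50) * (π / 50) * (π / 50) := by ring
        _ < 0.062832 * 0.062832 * 0.062832 := by gcongr
        _ < 0.000249 := by norm_num
    have hbase : (0.062788 : ℝ) < π / 50 - (π / 50) ^ 3 / 6 := by linarith
    nlinarith
  · have hu := lttHoppingAnisotropy_le_two_sq hx0.le hq
    nlinarith

end

end Literature.MathematicalPhysics.QuantumLattice
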